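import Literature.Probability.RandomPlanarGeometry.CritPercSLE
import Literature.Probability.RandomPlanarGeometry.ChordalBoundary
import Literature.Probability.RandomPlanarGeometry.SLEBoundaryHitting
import Literature.Probability.RandomPlanarGeometry.LoewnerChainProofs
import Literature.Probability.RandomPlanarGeometry.CaratheodoryExtension
import Literature.Analysis.FunctionSpaces.ItoProcesses
import HarnessLib

/-!
# Cardy's formula for SLE₆ in a conformal rectangle: reduction to the real Loewner flow

This file reduces the named fact `Literature.Probability.RandomPlanarGeometry.sle_six_measureReal_hitsBefore` of
`Literature.Probability.RandomPlanarGeometry.CritPercSLE` (**crit-perc.S21**, Cardy's formula for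
chordal SLE₆: for a conformal rectangle `R = (Ω; a, b, c, d)` and `μ` the law of chordal SLE₆ in
`(Ω; a, c)`, the probability that the curve hits the arc `(cd) = R.arc 2` before the arc
`(bc) = R.arc 1` is `F(η)`, `F = Literature.cardyFunction`, `η = crossRatio x` for any uniformizing
datum `(φ, x)` of `R`) to three named facts about the *real* Loewner flow of chordal SLE_κ in
`ℍ` (file `SLEBoundaryHitting`) and to Carathéodory's theorem in its printed disc form
(`Literature.Probability.RandomPlanarGeometry.JordanDomain.exists_continuousOn_extension`, Pommerenke (1992), Thm. 2.6), proving all the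
glue: `Literature.Probability.RandomPlanarGeometry.sle_six_measureReal_hitsBefore_of_facts`.

The cited source (Werner, *Lectures on two-dimensional critical percolation* (2007), §3, p. 19 of
arXiv:0710.0856) only says: "(if `x` is on the arc between `a` and `b`) it is the conditional
probability ... of the event that the curve `γ` hits the arc `ca` on `∂D` before the arc `bc`.
The computation (this is "Cardy's formula computation for SLE" in Greg Lawler's course) shows
that SLE(6) is the only SLE with this property", without a numbered statement. The printed
theorem behind it is Lawler, *Conformally Invariant Processes in the Plane* (2005), §6.7,
**Proposition 6.33** (p. 164): for chordal SLE_κ in `ℍ` from `0` to `∞`, `κ > 4`, `y > 0` and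
swallowing times `T_z`,
`P{T_{-y} > T_1} = Γ(2-4a)/(Γ(2-2a)Γ(1-2a)) (y/(y+1))^{1-2a} ₂F₁(2a, 1-2a; 2-2a; y/(y+1))`,
`a = 2/κ`, together with the sentence preceding it, "by scaling and symmetry
`P{T_{-y} > T_x} = P{T_y > T_{-x}} = P{T_{-y/x} > T_1}`" — vendored as
`Literature.Probability.RandomPlanarGeometry.sle_measureReal_swallowingTime_lt`. At `κ = 6` (`a = 1/3`) the right-hand side is
`Γ(2/3)/(Γ(4/3)Γ(1/3)) r^{1/3} ₂F₁(2/3, 1/3; 4/3; r) = F(r)` (`Γ(4/3) = Γ(1/3)/3`, symmetry of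
`₂F₁` in its first two parameters), proved below (`swallowingProb_one_third`).

## The reduction

Write `Γ` for an SLE₆ random curve with law `μ` (`Literature.Probability.RandomPlanarGeometry.IsSLECurve`): a.s. `Γ ω` is the class of
the time-compactified image `c_ω` of the SLE₆ trace `γ_ω` under the boundary extension `Ψ` of a
chordal uniformizing map `ψ : ℍₒ → Ω`, `0 ↦ a`, `∞ ↦ c`.

1. **Boundary correspondence** (proved from Carathéodory's theorem in `ChordalBoundary`:
   `ConformalRectangle.exists_rays_of_isChordalUniformizing_of_disc`): there are reals `u, v` of
   opposite signs with `Ψ⁻¹(arc (bc)) ∩ cl ℍₒ = realRay v`, `Ψ⁻¹(arc (cd)) ∩ cl ℍₒ = realRay u`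
   (closed real rays pointing away from `0`), and `crossRatio x = |v| / (|u| + |v|)` for every
   uniformizing datum `(φ, x)` of `R`.
2. Hence (proved, `mk_mem_hitsBefore_iff_firstHit_lt` and the assembly): a.s.,
   `Γ ω ∈ hitsBefore (arc 2) (arc 1)` iff the trace hits `realRay u` strictly before `realRay v`.
   The direction "⇒" needs a curve-space lemma (proved,
   `Curve.exists_mem_forall_lt_notMem_of_dist_eq_zero`): the event `hitsBefore A B` is defined
   through *some* representative of the class, and two representatives are only at
   reparametrisation distance zero; for closed `B`, if one representative hits `A` at a time
   before which (inclusively) it avoids `B`, then any curve at distance zero hits `A` at a time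
   before which (strictly) it avoids `B`. Ties are excluded because the two rays are disjoint
   and the positive one is a.s. hit (fact 4 below).
3. **Swallowing = hitting** (named fact `Literature.Probability.RandomPlanarGeometry.sle_swallowingTime_ofReal_eq_firstHit`, Lawler
   (2005), Rem. 6.6): `T_x = firstHit γ (realRay x)` for real `x ≠ 0`.
4. **Finiteness**: `κ > 4 ⇒` a.s. `T_x < ∞` for the (fixed) positive one of `u, v`; either from
   the named fact `Literature.Probability.RandomPlanarGeometry.sle_swallowingTime_ofReal_lt_top` (Lawler (2005), Prop. 6.8: w.p.1
   `T_x < ∞` for all `x > 0`; assembly `…_of_facts`) or from the per-point form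
   `Literature.Analysis.FunctionSpaces.sle_swallows_real_iff` of `Literature.Analysis.FunctionSpaces.ItoProcesses`
   (Rohde–Schramm (2005), Lemma 6.5; assembly `…_of_facts'`); the common core is
   `CritPerc.sle_six_measureReal_hitsBefore_of_ae`. In fact the former fact follows from the
   latter (`sle_swallowingTime_ofReal_lt_top_of_swallows`, proved: countably many points
   `x = n + 1` and monotonicity of `x ↦ T_x`, `Loewner.swallowingTime_mono_right` of
   `LoewnerChainProofs`).
5. **Lawler's Proposition 6.33** (named fact `Literature.Probability.RandomPlanarGeometry.sle_measureReal_swallowingTime_lt`):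
   `P{T_x < T_{-y}} = P{T_{-x} < T_y} = Ψₐ(y/(x+y))`, `Ψₐ = Literature.swallowingProb a`, `a = 2/κ`.
6. Measurability of the crossing event (`Literature.Probability.RandomPlanarGeometry.CurveClass.measurableSet_hitsBefore_holds` of
   `CurveSpace`, proved), to evaluate the push-forward measure on it.

Discharging facts 3–5 is left to `SLEBoundaryHitting` (fact 5 is the deep input: Itô calculus for
the Bessel-type flow `dX = (a/X) dt + dB`, optional stopping and the hypergeometric equation,
Lawler (2005), §1.10 and §6.7); Carathéodory's theorem is the input of item 1, and since it is
proved from the Jordan curve theorem in `CaratheodoryExtension`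
(`JordanDomain.exists_continuousOn_extension_of_jordanCurveTheorem`), the final reduction
`CritPerc.sle_six_measureReal_hitsBefore_of_jordanCurveTheorem` has exactly the literature inputs
3, 4 (per-point form), 5 and `Literature.Topology.PlaneTopology.JordanCurveTheorem`.

## Mathlib

We USE `Metric.thickening` and `IsCompact.exists_thickening_subset_open`,
`CompactSpace.tendsto_subseq` (Bolzano–Weierstrass on `[0,1]`),
`MeasureTheory.Measure.map_apply_of_aemeasurable`, `MeasureTheory.measure_congr`,
`ordinaryHypergeometricSeries_symm`, `Real.Gamma_add_one`. Hitting times: `Literature.Probability.RandomPlanarGeometry.firstHit`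
(= Mathlib's `MeasureTheory.hittingAfter · · 0`, see `firstHit_eq_hittingAfter` in
`SLEBoundaryHitting`). Mathlib has no SLE / Loewner chains / Cardy formula (searched `Loewner`,
`Cardy`, `swallow`).

## References

* G. F. Lawler, *Conformally Invariant Processes in the Plane*, AMS Math. Surveys 114 (2005):
  Rem. 6.6 (p. 148), Prop. 6.8 (p. 150), §6.7 Prop. 6.33 (p. 164), Cor. 6.35.
* W. Werner, *Lectures on two-dimensional critical percolation*, IAS/Park City (2007),
  arXiv:0710.0856, §3 (p. 19).
* G. Lawler, O. Schramm, W. Werner, *Values of Brownian intersection exponents I: Half-plane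
  exponents*, Acta Math. 187 (2001), §3 (Thm 3.2: the original SLE₆ crossing computation).
* Ch. Pommerenke, *Boundary Behaviour of Conformal Maps* (1992), Thm 2.6 (Carathéodory).
* M. Aizenman, A. Burchard, *Hölder regularity and dimension bounds for random curves*, Duke
  Math. J. 99 (1999), §2.1 (the space of curves modulo reparametrisation).
-/

noncomputable section

open Set Filter Topology MeasureTheory Complex
open UpperHalfPlane (upperHalfPlaneSet isOpen_upperHalfPlaneSet)
open scoped NNReal ENNReal unitInterval

namespace Literature.Probability.RandomPlanarGeometry

/-! ### Curve-space glue: hitting `A` before `B` at reparametrisation distance zero -/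

namespace Curve

variable {E : Type*} [MetricSpace E]

/-- **Hitting `A` before `B` passes to curves at reparametrisation distance zero, in weak form.**
Let `B` be closed. If `γ'` visits `A` at a time `t` with `γ' s ∉ B` for all `s ≤ t`, and
`dist γ γ' = 0` (so `γ, γ'` have the same class in `CurveClass E`), then `γ` visits `A` at some
time `s` with `γ r ∉ B` for all `r < s`. Proof: the initial segment `γ'[0,t]` is compact and off
`B`, hence a `δ`-thickening of it is off `B`; reparametrisations `φₙ` with
`‖γ - γ' ∘ φₙ‖ < δ/(n+2)` give times `sₙ = φₙ⁻¹ t` with `γ[0,sₙ] ∩ B = ∅` and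
`dist (γ sₙ) (γ' t) → 0`; any subsequential limit `s` of `sₙ` works. (Elementary; the metric on
curves is that of Aizenman–Burchard, Duke Math. J. 99 (1999), §2.1.) [folklore] -/
theorem exists_mem_forall_lt_notMem_of_dist_eq_zero {A B : Set E} (hB : IsClosed B)
    {γ γ' : Curve E} (h : dist γ γ' = 0) {t : I} (htA : γ' t ∈ A)
    (htB : ∀ s ≤ t, γ' s ∉ B) : ∃ s : I, γ s ∈ A ∧ ∀ r < s, γ r ∉ B := by
  have hγ'c : Continuous γ' := γ'.toContinuousMap.continuous
  have hγc : Continuous γ := γ.toContinuousMap.continuous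
  -- the initial segment of `γ'` is compact and misses the closed set `B`
  have hK : IsCompact ((γ' : I → E) '' Iic t) := isClosed_Iic.isCompact.image hγ'c
  have hKB : (γ' : I → E) '' Iic t ⊆ Bᶜ := by
    rintro _ ⟨s, hs, rfl⟩
    exact htB s hs
  obtain ⟨δ, hδ, hthick⟩ := hK.exists_thickening_subset_open hB.isOpen_compl hKB
  -- reparametrisations realising distance `< δ / (n + 2)`
  have hε : ∀ n : ℕ, dist γ γ' < δ / (n + 2) := fun n ↦ by rw [h]; positivity
  choose φ hφ using fun n ↦ exists_dist_reparam_lt (hε n)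
  have hclose : ∀ n (r : I), dist (γ r) (γ' (φ n r)) < δ / (n + 2) := fun n r ↦ by
    have h1 := ContinuousMap.dist_apply_le_dist (f := γ.toContinuousMap)
      (g := (γ'.reparam (φ n)).toContinuousMap) (x := r)
    simp only [coe_toContinuousMap, reparam_apply] at h1
    exact h1.trans_lt (hφ n)
  set s : ℕ → I := fun n ↦ (φ n).symm t with hs_def
  -- up to time `s n` the curve `γ` is `δ`-close to `γ'[0,t]`, hence off `B`
  have hsB : ∀ n, ∀ r ≤ s n, γ r ∉ B := by
    intro n r hr hrB
    have hφr : φ n r ≤ t := by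
      have := (φ n).monotone hr
      simpa [hs_def] using this
    have hle : δ / (n + 2) ≤ δ :=
      div_le_self hδ.le (by linarith [(n.cast_nonneg : (0 : ℝ) ≤ n)])
    have hmem : γ r ∈ Metric.thickening δ ((γ' : I → E) '' Iic t) := by
      rw [Metric.mem_thickening_iff]
      exact ⟨γ' (φ n r), ⟨φ n r, hφr, rfl⟩, (hclose n r).trans_le hle⟩
    exact hthick hmem hrB
  -- `γ (s n)` is close to `γ' t ∈ A`
  have hsA : ∀ n, dist (γ (s n)) (γ' t) < δ / (n + 2) := fun n ↦ by
    have := hclose n (s n)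
    simpa [hs_def] using this
  -- a subsequential limit of `s n`
  obtain ⟨s₀, ψ, hψ, hlim⟩ := CompactSpace.tendsto_subseq s
  refine ⟨s₀, ?_, ?_⟩
  · have h1 : Tendsto (fun k ↦ γ (s (ψ k))) atTop (𝓝 (γ s₀)) := (hγc.tendsto s₀).comp hlim
    have h2 : Tendsto (fun k ↦ γ (s (ψ k))) atTop (𝓝 (γ' t)) := by
      rw [tendsto_iff_dist_tendsto_zero]
      refine squeeze_zero (fun _ ↦ dist_nonneg) (fun k ↦ (hsA (ψ k)).le) ?_
      have hψ' : Tendsto (fun k ↦ (ψ k : ℝ) + 2) atTop atTop :=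
        tendsto_atTop_add_const_right _ _ (tendsto_natCast_atTop_atTop.comp hψ.tendsto_atTop)
      exact hψ'.const_div_atTop δ
    rw [tendsto_nhds_unique h1 h2]
    exact htA
  · intro r hr
    obtain ⟨k, hk⟩ := (hlim.eventually_const_lt hr).exists
    exact hsB (ψ k) r hk.le

end Curve

/-! ### The deterministic core: the crossing event of the compactified image -/

/-- The time compactification `rayParam s = s / (1 - s)` is order preserving and reflecting on
`[0, 1)`. [folklore] -/
theorem rayParam_le_rayParam_iff {s t : I} (hs : (s : ℝ) < 1) (ht : (t : ℝ) < 1) :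
    rayParam s ≤ rayParam t ↔ s ≤ t := by
  rw [← NNReal.coe_le_coe, coe_rayParam, coe_rayParam,
    div_le_div_iff₀ (by linarith) (by linarith), ← Subtype.coe_le_coe]
  constructor
  · intro h
    nlinarith [s.2.1, t.2.1]
  · intro h
    nlinarith [s.2.1, t.2.1]

/-- **Deterministic core of the transport.** Let `c` be the time-compactified image of the path
`γ` under `Ψ` (`Literature.Probability.RandomPlanarGeometry.IsCompactifiedImage`), let `A, B` be sets (`B` closed) whose `Ψ`-preimages along
`γ` are the closed sets `Su`, `Sv` (`Ψ (γ t) ∈ A ↔ γ t ∈ Su`, similarly for `B, Sv`), with `Su, Sv`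
disjoint and at least one of them hit by `γ`. Then the class of `c` lies in the crossing event
`hitsBefore A B` iff `γ` hits `Su` strictly before `Sv`. ("⇐": the representative `c` itself
witnesses the event; "⇒": a witnessing representative is at distance zero from `c`, so by
`Curve.exists_mem_forall_lt_notMem_of_dist_eq_zero` `c` hits `A` weakly before `B`, which excludes
`firstHit γ Sv < firstHit γ Su`; ties are excluded by disjointness.) [folklore] -/
theorem mk_mem_hitsBefore_iff_firstHit_lt {Ψ : ℂ → ℂ} {γ : ℝ≥0 → ℂ} {b : ℂ} {c : Curve ℂ}
    {A B Su Sv : Set ℂ} (hB : IsClosed B) (hSu : IsClosed Su)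
    (hSv : IsClosed Sv) (hdisj : Disjoint Su Sv) (hγ : Continuous γ)
    (hΨA : ∀ t, Ψ (γ t) ∈ A ↔ γ t ∈ Su) (hΨB : ∀ t, Ψ (γ t) ∈ B ↔ γ t ∈ Sv)
    (hc : IsCompactifiedImage Ψ γ b c) (hfin : firstHit γ Su < ⊤ ∨ firstHit γ Sv < ⊤) :
    CurveClass.mk c ∈ CurveClass.hitsBefore A B ↔ firstHit γ Su < firstHit γ Sv := by
  constructor
  · rintro ⟨γ', ⟨t, htA, htB⟩, hmk⟩
    have hdist : dist c γ' = 0 := by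
      rw [dist_comm]
      exact CurveClass.mk_eq_mk_iff_dist_eq_zero.1 hmk
    obtain ⟨s, hsA, hsB⟩ :=
      Curve.exists_mem_forall_lt_notMem_of_dist_eq_zero hB hdist htA htB
    rcases lt_trichotomy (firstHit γ Su) (firstHit γ Sv) with hlt | heq | hgt
    · exact hlt
    · exfalso
      have hu : firstHit γ Su ≠ ⊤ := by
        rcases hfin with h | h
        · exact h.ne
        · exact (heq ▸ h).ne
      obtain ⟨t₀, ht₀, hγt₀⟩ := exists_firstHit_eq_coe hγ hSu hu
      obtain ⟨t₁, ht₁, hγt₁⟩ := exists_firstHit_eq_coe hγ hSv (heq ▸ hu)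
      have h01 : t₀ = t₁ := WithTop.coe_injective (ht₀.symm.trans (heq.trans ht₁))
      exact hdisj.ne_of_mem hγt₀ hγt₁ (by rw [h01])
    · exfalso
      obtain ⟨t₁, ht₁, hγt₁⟩ := exists_firstHit_eq_coe hγ hSv hgt.ne_top
      obtain ⟨s₁, hs₁, hs₁t⟩ := exists_rayParam_eq t₁
      have hB₁ : c s₁ ∈ B := by
        rw [hc.1 s₁ hs₁, hΨB, hs₁t]
        exact hγt₁
      have hA₁ : ∀ s' ≤ s₁, c s' ∉ A := by
        intro s' hs' hs'A
        have hs'1 : (s' : ℝ) < 1 := lt_of_le_of_lt (Subtype.coe_le_coe.2 hs') hs₁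
        rw [hc.1 s' hs'1, hΨA] at hs'A
        refine notMem_of_lt_firstHit (lt_of_le_of_lt ?_ hgt) hs'A
        rw [ht₁, WithTop.coe_le_coe, ← hs₁t]
        exact (rayParam_le_rayParam_iff hs'1 hs₁).2 hs'
      rcases le_or_gt s s₁ with hss | hss
      · exact hA₁ s hss hsA
      · exact hsB s₁ hss hB₁
  · intro hlt
    obtain ⟨t₀, ht₀, hγt₀⟩ := exists_firstHit_eq_coe hγ hSu hlt.ne_top
    obtain ⟨s₀, hs₀, hs₀t⟩ := exists_rayParam_eq t₀
    refine CurveClass.mk_mem_hitsBefore (t := s₀) ?_ ?_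
    · rw [hc.1 s₀ hs₀, hΨA, hs₀t]
      exact hγt₀
    · intro s hs hsB
      have hs1 : (s : ℝ) < 1 := lt_of_le_of_lt (Subtype.coe_le_coe.2 hs) hs₀
      rw [hc.1 s hs1, hΨB] at hsB
      refine notMem_of_lt_firstHit (lt_of_le_of_lt ?_ hlt) hsB
      rw [ht₀, WithTop.coe_le_coe, ← hs₀t]
      exact (rayParam_le_rayParam_iff hs1 hs₀).2 hs

/-! ### The special-function identity at `κ = 6` -/

/-- At `a = 1/3` (`κ = 6`) Lawler's swallowing probability is Cardy's function:
`Γ(2/3)/(Γ(4/3)Γ(1/3)) r^{1/3} ₂F₁(2/3,1/3;4/3;r) = (3Γ(2/3)/Γ(1/3)²) r^{1/3} ₂F₁(1/3,2/3;4/3;r)`,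
by `Γ(4/3) = Γ(1/3)/3` and symmetry of `₂F₁` in its first two parameters (Lawler (2005),
Cor. 6.35 and §6.8: "if `κ = 6` ..."). [cite: Lawler2005, Cor. 6.35] -/
theorem swallowingProb_one_third : swallowingProb (1 / 3) = cardyFunction := by
  funext r
  have hG : Real.Gamma (4 / 3) = 1 / 3 * Real.Gamma (1 / 3) := by
    rw [show (4 / 3 : ℝ) = 1 / 3 + 1 by norm_num, Real.Gamma_add_one (by norm_num)]
  have hF : ₂F₁ (2 / 3 : ℝ) (1 / 3 : ℝ) (4 / 3 : ℝ) r = ₂F₁ (1 / 3 : ℝ) (2 / 3 : ℝ) (4 / 3 : ℝ) r := by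
    unfold ordinaryHypergeometric
    rw [ordinaryHypergeometricSeries_symm]
  have h0 : Real.Gamma (1 / 3) ≠ 0 := (Real.Gamma_pos_of_pos (by norm_num)).ne'
  simp only [swallowingProb, cardyFunction]
  norm_num
  rw [hG, hF]
  field_simp

/-! ### Assembly -/

/-- **Cardy's formula for SLE₆ in a conformal rectangle, from the named facts — common core**
(Lawler (2005), Prop. 6.33 at `κ = 6`; Werner (2007), §3 p. 19). Given (1) Lawler's swallowing
probabilities `sle_measureReal_swallowingTime_lt`, (2) swallowing = hitting of real rays
`sle_swallowingTime_ofReal_eq_firstHit`, (3) for each `x > 0`, a.s. finiteness of the SLE₆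
swallowing time `T_x` (supplied by either of two tree facts, see `…_of_facts`, `…_of_facts'`), and
Carathéodory's theorem in disc form `JordanDomain.exists_continuousOn_extension` (for the
boundary correspondence of the chordal uniformizing map,
`ConformalRectangle.exists_rays_of_isChordalUniformizing_of_disc`), the target statement
`CritPerc.sle_six_measureReal_hitsBefore` holds: unpack the SLE₆ law as the law of the class of
the compactified image `c_ω` of the trace under `Ψ`; a.s. `Γ ω ∈ hitsBefore (cd) (bc)` iff the
trace hits `realRay u` before `realRay v` (`mk_mem_hitsBefore_iff_firstHit_lt`) iff `T_u < T_v`;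
the probability of the latter is `swallowingProb (1/3) (|v|/(|u|+|v|)) = F(crossRatio x)`.
[cite: Lawler2005, Prop. 6.33] -/
theorem sle_six_measureReal_hitsBefore_of_ae (h₁ : sle_measureReal_swallowingTime_lt)
    (h₂ : sle_swallowingTime_ofReal_eq_firstHit)
    (h₃ : ∀ x : ℝ, 0 < x →
      ∀ᵐ ω ∂Process.preWienerMeasure, Loewner.swallowingTime (sleDriving 6 ω) x < ⊤)
    (hC : JordanDomain.exists_continuousOn_extension) :
    RandomPlanarGeometry.sle_six_measureReal_hitsBefore := by
  intro R μ hμ φ x hφ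
  obtain ⟨Γ, ⟨hΓm, ψ, hψ, hae⟩, rfl⟩ := hμ
  obtain ⟨u, v, huv, harc1, harc2, hcr⟩ :=
    ConformalRectangle.exists_rays_of_isChordalUniformizing_of_disc hC R hψ
  have h46 : (4 : ℝ≥0) < 6 := by norm_num
  have h26 : (2 : ℝ) / ((6 : ℝ≥0) : ℝ) = 1 / 3 := by norm_num
  rw [hcr φ x hφ, measureReal_def,
    Measure.map_apply_of_aemeasurable hΓm
      (CurveClass.measurableSet_hitsBefore_holds (R.isClosed_arc 2) (R.isClosed_arc 1))]
  -- the a.s. identification of the crossing event with `{T_u < T_v}`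
  have key : Γ ⁻¹' CurveClass.hitsBefore (R.arc 2) (R.arc 1) =ᵐ[Process.preWienerMeasure]
      {ω | Loewner.swallowingTime (sleDriving 6 ω) u <
        Loewner.swallowingTime (sleDriving 6 ω) v} := by
    have hpos : 0 < max u v := by
      rcases huv with ⟨-, hv⟩ | ⟨-, hu⟩
      · exact lt_max_of_lt_right hv
      · exact lt_max_of_lt_left hu
    filter_upwards [hae, h₃ (max u v) hpos] with ω hω hfinω
    obtain ⟨hgen, c, hΓc, hc⟩ := hω
    have hu0 : u ≠ 0 := by
      rcases huv with ⟨hu, -⟩ | ⟨-, hu⟩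
      · exact hu.ne
      · exact hu.ne'
    have hv0 : v ≠ 0 := by
      rcases huv with ⟨-, hv⟩ | ⟨hv, -⟩
      · exact hv.ne'
      · exact hv.ne
    have hTu := h₂ 6 ω hgen hu0
    have hTv := h₂ 6 ω hgen hv0
    have hfin : firstHit (sleTrace 6 ω) (realRay u) < ⊤ ∨
        firstHit (sleTrace 6 ω) (realRay v) < ⊤ := by
      rcases huv with ⟨hu, hv⟩ | ⟨hv, hu⟩
      · right
        rw [← hTv, ← max_eq_right (hu.trans hv).le]
        exact hfinω
      · left
        rw [← hTu, ← max_eq_left (hv.trans hu).le]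
        exact hfinω
    have hdisj : Disjoint (realRay u) (realRay v) := by
      rcases huv with ⟨hu, hv⟩ | ⟨hv, hu⟩
      · exact disjoint_realRay hu hv
      · exact (disjoint_realRay hv hu).symm
    have hiff := mk_mem_hitsBefore_iff_firstHit_lt (R.isClosed_arc 1)
      (isClosed_realRay u) (isClosed_realRay v) hdisj hgen.continuous
      (fun t ↦ harc2 _ (hgen.im_nonneg t)) (fun t ↦ harc1 _ (hgen.im_nonneg t)) hc hfin
    refine propext ?_
    change Γ ω ∈ CurveClass.hitsBefore (R.arc 2) (R.arc 1) ↔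
      Loewner.swallowingTime (sleDriving 6 ω) u < Loewner.swallowingTime (sleDriving 6 ω) v
    rw [hΓc, hTu, hTv]
    exact hiff
  rw [measure_congr key, ← measureReal_def]
  rcases huv with ⟨hu, hv⟩ | ⟨hv, hu⟩
  · have h := (h₁ h46 (neg_pos.2 hu) hv).2
    simp only [neg_neg] at h
    rw [h, abs_of_neg hu, abs_of_pos hv, h26, swallowingProb_one_third]
  · have h := (h₁ h46 hu (neg_pos.2 hv)).1
    simp only [neg_neg] at h
    rw [h, abs_of_pos hu, abs_of_neg hv, h26, swallowingProb_one_third]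

/-- **Lawler's Prop. 6.8 (second item) from Rohde–Schramm's Lemma 6.5**: a.s. finiteness of the
swallowing time of *every* positive real point for SLE_κ, `κ > 4`
(`sle_swallowingTime_ofReal_lt_top`), follows from the per-point statement
`sle_swallows_real_iff` (for each `x > 0`, a.s. `T_x < ∞`) applied to the countably many points
`x = n + 1`, `n : ℕ`, and the monotonicity of `x ↦ T_x` on `(0, ∞)` for continuous driving
functions (`Loewner.swallowingTime_mono_right`). [cite: Lawler2005, Prop. 6.8] -/
theorem sle_swallowingTime_ofReal_lt_top_of_swallows (h : Literature.Analysis.FunctionSpaces.sle_swallows_real_iff) :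
    sle_swallowingTime_ofReal_lt_top := by
  intro κ hκ
  have hκ0 : 0 < κ := lt_trans (by norm_num) hκ
  have hn : ∀ n : ℕ, ∀ᵐ ω ∂Process.preWienerMeasure,
      Loewner.swallowingTime (sleDriving κ ω) ((n + 1 : ℕ) : ℝ) < ⊤ := fun n ↦
    (h hκ0 (by positivity)).2 hκ
  filter_upwards [ae_all_iff.2 hn] with ω hω x hx
  obtain ⟨n, hn⟩ := exists_nat_gt x
  refine lt_of_le_of_lt ?_ (hω n)
  have hle : x ≤ ((n + 1 : ℕ) : ℝ) := by push_cast; linarith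
  have := Loewner.swallowingTime_mono_right (W := sleDriving κ ω) (continuous_sleDriving κ ω)
    (x := x) (x' := ((n + 1 : ℕ) : ℝ)) (by rw [sleDriving_zero]; exact hx) hle
  simpa using this

/-- **Cardy's formula for SLE₆ in a conformal rectangle, from the named facts** (Lawler (2005),
Prop. 6.33 at `κ = 6`; Werner (2007), §3 p. 19): the core `…_of_ae` with the finiteness input
taken from `sle_swallowingTime_ofReal_lt_top` (Lawler (2005), Prop. 6.8: for `κ > 4`, w.p.1
`T_x < ∞` for all `x > 0`). [cite: Lawler2005, Prop. 6.33] -/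
theorem sle_six_measureReal_hitsBefore_of_facts (h₁ : sle_measureReal_swallowingTime_lt)
    (h₂ : sle_swallowingTime_ofReal_eq_firstHit) (h₃ : sle_swallowingTime_ofReal_lt_top)
    (hC : JordanDomain.exists_continuousOn_extension) :
    RandomPlanarGeometry.sle_six_measureReal_hitsBefore :=
  RandomPlanarGeometry.sle_six_measureReal_hitsBefore_of_ae h₁ h₂
    (fun x hx ↦ (h₃ (by norm_num)).mono fun _ h ↦ h x hx) hC

/-- **Cardy's formula for SLE₆ in a conformal rectangle, from the named facts** (variant): the
core `…_of_ae` with the finiteness input taken from the per-point form `sle_swallows_real_iff`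
of `Literature.Analysis.FunctionSpaces.ItoProcesses` (Rohde–Schramm, Ann. of Math. 161 (2005),
Lemma 6.5: for `κ > 4` and `x > 0`, a.s. `T_x < ∞`). [cite: Lawler2005, Prop. 6.33] -/
theorem sle_six_measureReal_hitsBefore_of_facts' (h₁ : sle_measureReal_swallowingTime_lt)
    (h₂ : sle_swallowingTime_ofReal_eq_firstHit) (h₃ : Literature.Analysis.FunctionSpaces.sle_swallows_real_iff)
    (hC : JordanDomain.exists_continuousOn_extension) :
    RandomPlanarGeometry.sle_six_measureReal_hitsBefore :=
  RandomPlanarGeometry.sle_six_measureReal_hitsBefore_of_ae h₁ h₂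
    (fun _ hx ↦ (h₃ (by norm_num) hx).2 (by norm_num)) hC

/-- **Cardy's formula for SLE₆ in a conformal rectangle, from the SLE facts and the Jordan curve
theorem**: as `…_of_facts'`, with Carathéodory's theorem supplied by its proof from the Jordan
curve theorem (`JordanDomain.exists_continuousOn_extension_of_jordanCurveTheorem` of
`Literature.Probability.RandomPlanarGeometry.CaratheodoryExtension`). The remaining literature
inputs of Cardy's formula for SLE₆ are thus: Lawler's Prop. 6.33 (`h₁`), swallowing = hitting of
real rays (`h₂`, Lawler Rem. 6.6), a.s. swallowing of positive reals for `κ > 4` (`h₃`,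
Rohde–Schramm Lemma 6.5) and the Jordan curve theorem (`hJ`). [cite: Lawler2005, Prop. 6.33] -/
theorem sle_six_measureReal_hitsBefore_of_jordanCurveTheorem
    (h₁ : sle_measureReal_swallowingTime_lt) (h₂ : sle_swallowingTime_ofReal_eq_firstHit)
    (h₃ : Literature.Analysis.FunctionSpaces.sle_swallows_real_iff) (hJ : Literature.Topology.PlaneTopology.JordanCurveTheorem) :
    RandomPlanarGeometry.sle_six_measureReal_hitsBefore :=
  RandomPlanarGeometry.sle_six_measureReal_hitsBefore_of_facts' h₁ h₂ h₃
    (JordanDomain.exists_continuousOn_extension_of_jordanCurveTheorem hJ)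

end Literature.Probability.RandomPlanarGeometry
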